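import Summits.QuantumFields.YangMills.Theses.HyperbolicRegulator

/-!
# Route `HyperbolicRegulator`, crux `CurvatureUniformityR` (stmt-QuantumFields-18154): the LOCAL / FAR cut

Lead prover `prover-line-stmt-QuantumFields-18154-0` (line `single-chart-markov`, crux idea card
`Cruxes/CurvatureUniformityR/Ideas/single-chart-markov.md`, crux-ideate r1 k2; k1 twin `Ideate1Sketch.InChartUniformityR`), 2026-08-17.

The typed crux is cut along ONE extra binder in the clustering predicate of the shared `let Fam`:

* `CurvatureUniformityLocalR` (LOCAL) — the crux verbatim, clustering asked only for SINGLE-CHART pairs of flat base points,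
  `Γ.dist x y + Γ.dist x' y' ≤ k / 16` (both chart-read observables then sit inside one flat `ℤ⁴` chart product box of
  sup-radius `k/4`). This is the only regime the route's assembly consumes: `closes` uses the crux only as the hypothesis of
  `HyperbolicToTorusR`, whose registered skeletons (`Cruxes/HyperbolicToTorusR/Lines/replica_rooting.lean`,
  `uniqueness_transfer.lean`) evaluate the clustering table at in-chart pairs only (k → ∞ at fixed separation).
* `CurvatureUniformityFarR` (FAR) — the complementary far regime `k / 16 < Γ.dist x y + Γ.dist x' y'`: unconsumed, and believed
  FALSE on the typed family class (strategist census `Cruxes/CurvatureUniformityR/STRATEGY-CENSUS.md` N1′, crux idea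
  `periscope-films`: admissibility leaves cone cores free, pinched cores hide finite-temperature films).
* `curvatureUniformityR_of_local_far : LOCAL → FAR → CurvatureUniformityR` — the glue, sorry-free: thresholds `max`, rate `min`,
  constant `max (max C C') 0`, case split of each flat quadruple on the product distance; the anchor hypothesis of each half is
  the crux's anchor with the extra binder discarded.

Both halves are stated FULLY INLINED with `let`-preambles byte-identical to the crux's (as the sibling split
`HyperbolicRegulatorCurvatureUniformityRSplit.lean`, p167706), so hypotheses pass across by ζ/β/proj-reduction. Nothing here is
asserted about the route: two definitions and one implication. RESTATE ADVICE it supports (three planner seats converged on it):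
18154 := LOCAL, with the same binder inserted in `HyperbolicToTorusR`'s hypothesis in lockstep.
-/

set_option autoImplicit false

noncomputable section

namespace Summit.QuantumFields.YangMills.Cruxes.CurvatureUniformityR.SingleChartMarkov

/-- **LOCAL — `CurvatureUniformityLocalR`.** `CurvatureUniformityR` verbatim except that the clustering predicate (second
component of the shared `let Fam`) only quantifies over SINGLE-CHART pairs: the one inserted hypothesis
`Γ.dist x y + Γ.dist x' y' ≤ k / 16 →` after `F y' →` (byte-identical with `Cruxes/…/Ideate1Sketch.lean`'s `InChartUniformityR`). -/
def CurvatureUniformityLocalR : Prop :=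
  open Literature.MathematicalPhysics.QuantumFieldTheory Literature.MathematicalPhysics.QuantumLattice MeasureTheory in ∀ (G : Type) [Group G] [TopologicalSpace G] [IsTopologicalGroup G] [CompactSpace G], IsCompactSimpleLieGroup G → letI : MeasurableSpace G := borel G; haveI : BorelSpace G := ⟨rfl⟩; ∀ r : LatticeRep G, let Fam := fun (k j : ℕ) (V E Q : Finset ℕ) (σ τ : ℕ → ℕ) (bd : ℕ → Fin 4 → ℕ × Bool) (cV : ℕ → ℤ × ℤ → ℕ) (cE : ℕ → ℤ × ℤ → Fin 2 → ℕ × Bool) => let st := fun e : ℕ × Bool => if e.2 then σ e.1 else τ e.1; let en := fun e : ℕ × Bool => if e.2 then τ e.1 else σ e.1; let Γ := SimpleGraph.fromRel fun a b : ℕ => ∃ e ∈ E, σ e = a ∧ τ e = b; let dg := fun x : ℕ => (E.filter fun e => σ e = x ∨ τ e = x).card; let K := V.filter fun x => dg x = 5; let F := fun x : ℕ => x ∈ V ∧ ∀ c ∈ K, k / 2 < Γ.dist x c; let Dp := fun x : ℕ => x ∈ V ∧ ∀ c ∈ K, 3 * (k / 4) < Γ.dist x c; let ib := fun a : ℤ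 × ℤ => |a.1| ≤ (k : ℤ) / 4 ∧ |a.2| ≤ (k : ℤ) / 4; let nx := fun (a : ℤ × ℤ) (μ : Fin 2) => if μ = 0 then (a.1 + 1, a.2) else (a.1, a.2 + 1); let Ed := (ℕ × ℕ) ⊕ (ℕ × ℕ); let PE : Finset Ed := (E ×ˢ V).disjSum (V ×ˢ E); let Cfg := ↥PE → G; let ν := Measure.pi fun _ : ↥PE => haarProbability G; let v := fun (U : Cfg) (e : Ed × Bool) => if h : e.1 ∈ PE then (if e.2 then U ⟨e.1, h⟩ else (U ⟨e.1, h⟩)⁻¹) else 1; let w := fun (U : Cfg) (e : Fin 4 → Ed × Bool) => (r.ρ (v U (e 0) * v U (e 1) * v U (e 2) * v U (e 3))).trace.re; let S := fun U : Cfg => (∑ q ∈ Q, ∑ y ∈ V, w U fun i => (Sum.inl ((bd q i).1, y), (bd q i).2)) + (∑ y ∈ V, ∑ q ∈ Q, w U fun i => (Sum.inr (y, (bd q i).1), (bd q i).2)) + ∑ e ∈ E, ∑ e' ∈ E, w U ![(Sum.inl (e, σ e'), true), (Sum.inr (τ e, e'), true), (Sum.inl (e, τ e'), false), (Sum.inr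 (σ e, e'), false)]; let d0 : Fin 4 → Fin 2 := ![0, 1, 0, 1]; let P := fun (x x' : ℕ) (U : Cfg) (p : ZdEdge 4) => let a := (p.1 0, p.1 1); let b := (p.1 2, p.1 3); if p.2 = 0 ∨ p.2 = 1 then v U (Sum.inl ((cE x a (d0 p.2)).1, cV x' b), (cE x a (d0 p.2)).2) else v U (Sum.inr (cV x a, (cE x' b (d0 p.2)).1), (cE x' b (d0 p.2)).2); ((∀ e ∈ E, σ e ∈ V ∧ τ e ∈ V ∧ σ e ≠ τ e) ∧ (∀ q ∈ Q, (∀ i, (bd q i).1 ∈ E) ∧ (∀ i, en (bd q i) = st (bd q (i + 1))) ∧ (st ∘ bd q).Injective) ∧ (∀ e ∈ E, (Q.filter fun q => ∃ i, (bd q i).1 = e).card = 2) ∧ (∀ x ∈ V, (dg x = 4 ∨ dg x = 5) ∧ (Q.filter fun q => ∃ i, st (bd q i) = x).card = dg x) ∧ (∀ x ∈ V, ∃ c ∈ K, Γ.dist x c ≤ k) ∧ (∀ c ∈ K, ∀ c' ∈ K, c ≠ c' → k ≤ Γ.dist c c') ∧ (∀ f : ℕ → ℝ, ∑ x ∈ V,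 f x = 0 → ∑ x ∈ V, f x ^ 2 ≤ 10 ^ 6 * (k : ℝ) ^ 2 * ∑ e ∈ E, (f (σ e) - f (τ e)) ^ 2) ∧ (∃ x y, Dp x ∧ Dp y ∧ j ≤ Γ.dist x y) ∧ (∀ x, F x → cV x (0, 0) = x ∧ (∀ a, ib a → cV x a ∈ V) ∧ Set.InjOn (cV x) {a | ib a} ∧ (∀ a μ, ib a → ib (nx a μ) → (cE x a μ).1 ∈ E ∧ st (cE x a μ) = cV x a ∧ en (cE x a μ) = cV x (nx a μ)) ∧ (∀ a, ib a → ib (a.1 + 1, a.2 + 1) → ∃ q ∈ Q, Finset.univ.image (Prod.fst ∘ bd q) = {(cE x a 0).1, (cE x (nx a 0) 1).1, (cE x (nx a 1) 0).1, (cE x a 1).1})), fun (β m C : ℝ) (A B : YMSpecies G) => let X := fun f : Cfg → ℝ => (∫ U, f U * Real.exp (β * S U) ∂ν) / (∫ U, Real.exp (β * S U) ∂ν); ∀ x x' y y', F x → F x' → F y → F y' → Γ.dist x y + Γ.dist x' y' ≤ k / 16 → |X (fun U => A.F (P x x' U) * B.F (P y y' U)) - X (fun U => A.F (P x x' U)) *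 X (fun U => B.F (P y y' U))| ≤ C * Real.exp (-(m * ((Γ.dist x y + Γ.dist x' y' : ℕ) : ℝ)))); let Sp := fun (A : YMSpecies G) (R : ℕ) => ∀ p ∈ A.supp, ∀ i, |p.1 i| ≤ (R : ℤ); ∀ (V E Q : ℕ → ℕ → Finset ℕ) (σ τ : ℕ → ℕ → ℕ → ℕ) (bd : ℕ → ℕ → ℕ → Fin 4 → ℕ × Bool) (cV : ℕ → ℕ → ℕ → ℤ × ℤ → ℕ) (cE : ℕ → ℕ → ℕ → ℤ × ℤ → Fin 2 → ℕ × Bool), let Φ := fun k j => Fam k j (V k j) (E k j) (Q k j) (σ k j) (τ k j) (bd k j) (cV k j) (cE k j); (∀ k j, 8 ≤ k → (Φ k j).1) → (∃ c : ℝ, 0 < c ∧ ∀ k, 8 ≤ k → ∃ β₀ : ℝ, ∀ β, β₀ ≤ β → ∀ A B : YMSpecies G, Sp A (k / 8) → Sp B (k / 8) → ∃ C j₀, ∀ j, j₀ ≤ j → (Φ k j).2 β (c / k) C A B) → (∃ β₁ : ℝ, ∀ β, β₁ ≤ β → ∃ m : ℝ, 0 < m ∧ ∀ A B : YMSpecies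 G, ∃ C : ℝ, ∃ K : ℕ, ∀ k, K ≤ k → Sp A (k / 8) → Sp B (k / 8) → ∃ j₀ : ℕ, ∀ j, j₀ ≤ j → (Φ k j).2 β m C A B)

/-- **FAR — `CurvatureUniformityFarR`.** `CurvatureUniformityR` verbatim except that the clustering predicate only quantifies
over FAR pairs: the one inserted hypothesis `k / 16 < Γ.dist x y + Γ.dist x' y' →` after `F y' →`. Unconsumed by `closes`;
believed false on the typed family class (periscope films). -/
def CurvatureUniformityFarR : Prop :=
  open Literature.MathematicalPhysics.QuantumFieldTheory Literature.MathematicalPhysics.QuantumLattice MeasureTheory in ∀ (G : Type) [Group G] [TopologicalSpace G] [IsTopologicalGroup G] [CompactSpace G], IsCompactSimpleLieGroup G → letI : MeasurableSpace G := borel G; haveI : BorelSpace G := ⟨rfl⟩; ∀ r : LatticeRep G, let Fam := fun (k j : ℕ) (V E Q : Finset ℕ) (σ τ : ℕ → ℕ) (bd : ℕ → Fin 4 → ℕ × Bool) (cV : ℕ → ℤ × ℤ → ℕ) (cE : ℕ → ℤ × ℤ → Fin 2 → ℕ × Bool) => let st := fun e : ℕ × Bool => if e.2 then σ e.1 else τ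 e.1; let en := fun e : ℕ × Bool => if e.2 then τ e.1 else σ e.1; let Γ := SimpleGraph.fromRel fun a b : ℕ => ∃ e ∈ E, σ e = a ∧ τ e = b; let dg := fun x : ℕ => (E.filter fun e => σ e = x ∨ τ e = x).card; let K := V.filter fun x => dg x = 5; let F := fun x : ℕ => x ∈ V ∧ ∀ c ∈ K, k / 2 < Γ.dist x c; let Dp := fun x : ℕ => x ∈ V ∧ ∀ c ∈ K, 3 * (k / 4) < Γ.dist x c; let ib := fun a : ℤ × ℤ => |a.1| ≤ (k : ℤ) / 4 ∧ |a.2| ≤ (k : ℤ) / 4; let nx := fun (a : ℤ × ℤ) (μ : Fin 2) => if μ = 0 then (a.1 + 1, a.2) else (a.1, a.2 + 1); let Ed := (ℕ × ℕ) ⊕ (ℕ × ℕ); let PE : Finset Ed := (E ×ˢ V).disjSum (V ×ˢ E); let Cfg := ↥PE → G; let ν := Measure.pi fun _ : ↥PE => haarProbability G; let v := fun (U : Cfg) (e : Ed × Bool) => if h : e.1 ∈ PE then (if e.2 then U ⟨e.1, h⟩ else (U ⟨e.1, h⟩)⁻¹) else 1; let w := fun (U : Cfg) (e : Fin 4 →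 Ed × Bool) => (r.ρ (v U (e 0) * v U (e 1) * v U (e 2) * v U (e 3))).trace.re; let S := fun U : Cfg => (∑ q ∈ Q, ∑ y ∈ V, w U fun i => (Sum.inl ((bd q i).1, y), (bd q i).2)) + (∑ y ∈ V, ∑ q ∈ Q, w U fun i => (Sum.inr (y, (bd q i).1), (bd q i).2)) + ∑ e ∈ E, ∑ e' ∈ E, w U ![(Sum.inl (e, σ e'), true), (Sum.inr (τ e, e'), true), (Sum.inl (e, τ e'), false), (Sum.inr (σ e, e'), false)]; let d0 : Fin 4 → Fin 2 := ![0, 1, 0, 1]; let P := fun (x x' : ℕ) (U : Cfg) (p : ZdEdge 4) => let a := (p.1 0, p.1 1); let b := (p.1 2, p.1 3); if p.2 = 0 ∨ p.2 = 1 then v U (Sum.inl ((cE x a (d0 p.2)).1, cV x' b), (cE x a (d0 p.2)).2) else v U (Sum.inr (cV x a, (cE x' b (d0 p.2)).1), (cE x' b (d0 p.2)).2); ((∀ e ∈ E, σ e ∈ V ∧ τ e ∈ V ∧ σ e ≠ τ e) ∧ (∀ q ∈ Q, (∀ i, (bd q i).1 ∈ E) ∧ (∀ i, en (bd q i) = st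 (bd q (i + 1))) ∧ (st ∘ bd q).Injective) ∧ (∀ e ∈ E, (Q.filter fun q => ∃ i, (bd q i).1 = e).card = 2) ∧ (∀ x ∈ V, (dg x = 4 ∨ dg x = 5) ∧ (Q.filter fun q => ∃ i, st (bd q i) = x).card = dg x) ∧ (∀ x ∈ V, ∃ c ∈ K, Γ.dist x c ≤ k) ∧ (∀ c ∈ K, ∀ c' ∈ K, c ≠ c' → k ≤ Γ.dist c c') ∧ (∀ f : ℕ → ℝ, ∑ x ∈ V, f x = 0 → ∑ x ∈ V, f x ^ 2 ≤ 10 ^ 6 * (k : ℝ) ^ 2 * ∑ e ∈ E, (f (σ e) - f (τ e)) ^ 2) ∧ (∃ x y, Dp x ∧ Dp y ∧ j ≤ Γ.dist x y) ∧ (∀ x, F x → cV x (0, 0) = x ∧ (∀ a, ib a → cV x a ∈ V) ∧ Set.InjOn (cV x) {a | ib a} ∧ (∀ a μ, ib a → ib (nx a μ) → (cE x a μ).1 ∈ E ∧ st (cE x a μ) = cV x a ∧ en (cE x a μ) = cV x (nx a μ)) ∧ (∀ a, ib a → ib (a.1 + 1, a.2 + 1) → ∃ q ∈ Q, Finset.univ.image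 (Prod.fst ∘ bd q) = {(cE x a 0).1, (cE x (nx a 0) 1).1, (cE x (nx a 1) 0).1, (cE x a 1).1})), fun (β m C : ℝ) (A B : YMSpecies G) => let X := fun f : Cfg → ℝ => (∫ U, f U * Real.exp (β * S U) ∂ν) / (∫ U, Real.exp (β * S U) ∂ν); ∀ x x' y y', F x → F x' → F y → F y' → k / 16 < Γ.dist x y + Γ.dist x' y' → |X (fun U => A.F (P x x' U) * B.F (P y y' U)) - X (fun U => A.F (P x x' U)) * X (fun U => B.F (P y y' U))| ≤ C * Real.exp (-(m * ((Γ.dist x y + Γ.dist x' y' : ℕ) : ℝ)))); let Sp := fun (A : YMSpecies G) (R : ℕ) => ∀ p ∈ A.supp, ∀ i, |p.1 i| ≤ (R : ℤ); ∀ (V E Q : ℕ → ℕ → Finset ℕ) (σ τ : ℕ → ℕ → ℕ → ℕ) (bd : ℕ → ℕ → ℕ → Fin 4 → ℕ × Bool) (cV : ℕ → ℕ → ℕ → ℤ × ℤ → ℕ) (cE : ℕ → ℕ → ℕ → ℤ × ℤ → Fin 2 → ℕ × Bool), let Φ := fun k j => Fam k j (V k j) (E k j) (Q k j) (σ k j)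 (τ k j) (bd k j) (cV k j) (cE k j); (∀ k j, 8 ≤ k → (Φ k j).1) → (∃ c : ℝ, 0 < c ∧ ∀ k, 8 ≤ k → ∃ β₀ : ℝ, ∀ β, β₀ ≤ β → ∀ A B : YMSpecies G, Sp A (k / 8) → Sp B (k / 8) → ∃ C j₀, ∀ j, j₀ ≤ j → (Φ k j).2 β (c / k) C A B) → (∃ β₁ : ℝ, ∀ β, β₁ ≤ β → ∃ m : ℝ, 0 < m ∧ ∀ A B : YMSpecies G, ∃ C : ℝ, ∃ K : ℕ, ∀ k, K ≤ k → Sp A (k / 8) → Sp B (k / 8) → ∃ j₀ : ℕ, ∀ j, j₀ ≤ j → (Φ k j).2 β m C A B)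

/-- Monotonicity of an exponential clustering bound in the constant and the rate. [folklore] -/
theorem le_mul_exp_neg_mono {a C C₀ m m₀ d : ℝ} (hd : 0 ≤ d) (h : a ≤ C * Real.exp (-(m * d)))
    (hC : C ≤ C₀) (hC₀ : 0 ≤ C₀) (hm : m₀ ≤ m) : a ≤ C₀ * Real.exp (-(m₀ * d)) := by
  refine h.trans ?_
  have h1 : C * Real.exp (-(m * d)) ≤ C₀ * Real.exp (-(m * d)) :=
    mul_le_mul_of_nonneg_right hC (Real.exp_pos _).le
  refine h1.trans (mul_le_mul_of_nonneg_left ?_ hC₀)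
  exact Real.exp_le_exp.2 (by nlinarith)

/-- **The glue: LOCAL ∧ FAR ⇒ `CurvatureUniformityR`.** Take `β₁ = max`, `m = min`, `C = max (max C C') 0`, `K = max`,
`j₀ = max`, and split each quadruple of flat base points on `Γ.dist x y + Γ.dist x' y' ≤ k / 16`; the anchor hypothesis of each
half is the crux's anchor with the extra binder discarded. -/
theorem curvatureUniformityR_of_local_far (hL : CurvatureUniformityLocalR) (hF : CurvatureUniformityFarR) :
    Summit.QuantumFields.YangMills.Theses.HyperbolicRegulator.CurvatureUniformityR := by
  intro G _ _ _ _ hG r Fam Sp V E Q σ τ bd cV cE Φ hAdm hAnch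
  obtain ⟨c, hc, hAk⟩ := hAnch
  -- LOCAL, fed with the crux's data, admissibility and (weakened) anchor
  have hLc := hL G hG r V E Q σ τ bd cV cE hAdm (by
    refine ⟨c, hc, fun k hk => ?_⟩
    obtain ⟨β₀, hβ₀⟩ := hAk k hk
    refine ⟨β₀, fun β hβ A B hA hB => ?_⟩
    obtain ⟨C, j₀, hj⟩ := hβ₀ β hβ A B hA hB
    refine ⟨C, j₀, fun j hjj => ?_⟩
    have h := hj j hjj
    intro x x' y y' hx hx' hy hy' _
    exact h x x' y y' hx hx' hy hy')
  -- FAR, likewise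
  have hFc := hF G hG r V E Q σ τ bd cV cE hAdm (by
    refine ⟨c, hc, fun k hk => ?_⟩
    obtain ⟨β₀, hβ₀⟩ := hAk k hk
    refine ⟨β₀, fun β hβ A B hA hB => ?_⟩
    obtain ⟨C, j₀, hj⟩ := hβ₀ β hβ A B hA hB
    refine ⟨C, j₀, fun j hjj => ?_⟩
    have h := hj j hjj
    intro x x' y y' hx hx' hy hy' _
    exact h x x' y y' hx hx' hy hy')
  obtain ⟨β₁, hβ₁⟩ := hLc
  obtain ⟨β₁', hβ₁'⟩ := hFc
  refine ⟨max β₁ β₁', fun β hβ => ?_⟩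
  obtain ⟨m, hm, hAB⟩ := hβ₁ β ((le_max_left _ _).trans hβ)
  obtain ⟨m', hm', hAB'⟩ := hβ₁' β ((le_max_right _ _).trans hβ)
  refine ⟨min m m', lt_min hm hm', fun A B => ?_⟩
  obtain ⟨C, K, hK⟩ := hAB A B
  obtain ⟨C', K', hK'⟩ := hAB' A B
  refine ⟨max (max C C') 0, max K K', fun k hk hA hB => ?_⟩
  obtain ⟨j₀, hj₀⟩ := hK k ((le_max_left _ _).trans hk) hA hB
  obtain ⟨j₀', hj₀'⟩ := hK' k ((le_max_right _ _).trans hk) hA hB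
  refine ⟨max j₀ j₀', fun j hj => ?_⟩
  have h1 := hj₀ j ((le_max_left _ _).trans hj)
  have h2 := hj₀' j ((le_max_right _ _).trans hj)
  intro x x' y y' hx hx' hy hy'
  by_cases hd : (SimpleGraph.fromRel fun a b : ℕ => ∃ e ∈ E k j, σ k j e = a ∧ τ k j e = b).dist x y
      + (SimpleGraph.fromRel fun a b : ℕ => ∃ e ∈ E k j, σ k j e = a ∧ τ k j e = b).dist x' y' ≤ k / 16
  · exact le_mul_exp_neg_mono (Nat.cast_nonneg _) (h1 x x' y y' hx hx' hy hy' hd)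
      ((le_max_left _ _).trans (le_max_left _ _)) (le_max_right _ _) (min_le_left _ _)
  · exact le_mul_exp_neg_mono (Nat.cast_nonneg _) (h2 x x' y y' hx hx' hy hy' (lt_of_not_ge hd))
      ((le_max_right _ _).trans (le_max_left _ _)) (le_max_right _ _) (min_le_right _ _)

end Summit.QuantumFields.YangMills.Cruxes.CurvatureUniformityR.SingleChartMarkov

end
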